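import Summits.NavierStokesRegularity.NavierStokesRegularity.Theorems.ArgmaxDoorsThreshold
import Summits.NavierStokesRegularity.NavierStokesRegularity.Theorems.StrainDoorsPoissonTrace
import Literature.Analysis.FluidPDE.EnergyToolkit
import Literature.Analysis.FluidPDE.PressurePoisson
import Literature.Analysis.FluidPDE.DeviatoricHessian
import HarnessLib

/-!
# Sketch37 — door family S37 «StrainDoors» (nsreg-p1 g31, ROUND-35): texts of record + kernel-checked compositions

The STRAIN member of the argmax / max-norm family (twin of S35 «ArgmaxDoors»). The object is the TOP STRAIN
EIGENVALUE `Λ(t) = sup_{x, |e| = 1} ⟪∇u(t,x) e, e⟫` (`= sup_x λ₃(S(t,x))`, `S = ½(∇u + ∇uᵀ)`), the only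
one-point quantity the Beale–Kato–Majda mechanism needs besides `‖ω‖_∞`, which it SLAVES:
`d⁺/dt ‖ω(t)‖_∞ ≤ Λ(t)‖ω(t)‖_∞` (plate E1 of S35 + `α = ⟪ξ,Sξ⟫ ≤ λ₃`). At an argmax `(x̄, ē)` of the strain
form the gradient equation `∂ₜA + (u·∇)A + A² = −∇²p + νΔA` (`A = ∇u`, Majda–Bertozzi (1.29)) loses its
transport term (`∇_x⟪A(·)ē,ē⟫(x̄) = 0`), its viscous term has a sign (`Δ_x⟪A(·)ē,ē⟫(x̄) ≤ 0`), and
`⟪A²ē,ē⟫ = ⟪Aē, Aᵀē⟫ = |Sē|² − ¼|ω × ē|² ≥ Λ² − ¼(|ω|² − ⟪ω,ē⟫²)`, so that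

  `∂ₜ⟪A ē, ē⟫(x̄, t) ≤ −Λ(t)² + H(x̄, ē, t)`,  `H := ¼(|ω|² − ⟪ω,ē⟫²) − ∇²p(ē,ē)`   (plate E1_S «StrainGrowth»).

With `y(t) := (T − t)Λ(t)` this reads `(T − t) y' ≤ (T−t)²H − y − y²`: if the STRAIN FEED `H` at the strain
argmaxes above the line `Λ > y₀/(T−t)` obeys `(T − t)²H ≤ c` with `c < y₀(1 + y₀)`, `y₀ < 1`, a two-slab
barrier (plate E2_S «StrainThreshold», the first-touch device for the `(x,e)`-family) forces `(T − t)Λ(t) ≤ y₀`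
on a final slab, hence `(T − t)·netStretch ≤ y₀|ω|²` at every vorticity argmax, i.e. the hypothesis of the CLOSED
door S35-B `ArgmaxSubcriticalDoor` (`argmaxSubcriticalDoor_holds_of_threshold`, p646275) ⇒ continuation.
The Restricted-Euler collapse (Vieillefosse 1982 / Cantwell 1992: `Ȧ = −A² + ⅓tr(A²)𝟙`) sits EXACTLY on the
borderline `y ≡ 1`, `(T−t)²H ≡ 2`.

* door S37-Λ «SubcriticalStrainDoor»: `(T − t)⟪∇u(t,x)e,e⟫ ≤ y₀ < 1` for all `x`, unit `e`, late `t` ⇒ extension.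
  CLOSED below from S35-B by name (`subcriticalStrainDoor_holds`).
* door S37-H «StrainFeedingDoor»: charged ONLY at strain argmaxes `(x̄,ē)` with `(T − t)⟪∇u ē,ē⟫ > y₀`:
  `(T − t)²·(¼(|ω|² − ⟪ω,ē⟫²) − ∇²p(ē,ē)) ≤ c`, `c < y₀(1+y₀)` ⇒ extension. Composition
  `strainFeedingDoor_of : StrainGrowth → StrainFrame → StrainThreshold → SubcriticalStrainDoor → StrainFeedingDoor`.
* door S37-Π «PressureFocusingDoor»: the same hypothesis with the pressure Hessian split by the Poisson equation
  `Δp = ½|ω|² − |S|²` into ISOTROPIC + DEVIATORIC parts: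
  `H = ⅓|S|² + (1/12)|ω|² − ¼⟪ω,ē⟫² − Π(ē,ē)`, `Π = ∇²p − ⅓Δp·𝟙` (the zero-spherical-mean Calderón–Zygmund
  part): SHAPE + ALIGNMENT + NONLOCAL FOCUSING. Composition `pressureFocusingDoor_of : PoissonTrace →
  StrainFeedingDoor → PressureFocusingDoor`.
* plates: E1_S «StrainGrowth» (M, PDE-free vector calculus at a strain argmax), F_S «StrainFrame» (S, the
  momentum equation differentiated along `e`: `EnergyToolkit`'s `timeDerivWithin_fderiv_slice_apply`), E2_S
  «StrainThreshold» (M, Riccati first-touch comparison for the `(x,e)`-family on a slab, additive device),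
  «PoissonTrace» (S, `Δp = |ω|² − |∇u|²_F` pointwise).

HONEST LABEL: regularity CRITERIA (threshold doors like S35-B, not Type-I-automatic); the pointwise strain
equation is classical (Majda–Bertozzi 2002 (1.29)–(1.30); eigenframe form Nomura–Post 1998, Dresselhaus–Tabor 1991);
what is typed here and not in print is the max-norm/threshold continuation criterion for the TOP strain eigenvalue
with the pressure Hessian charged only at its argmax. WHAT THIS IS NOT: item 0056 `NoTypeII` / NS regularity are
NOT proved; no Literature fact is a hypothesis; nothing here is a route or a summit statement
(`--supports stmt-NavierStokesRegularity-0056 --as helper`).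
-/

/-!
## Landing note (P0-37, part 1 of 3)
Texts of record of door family S37 «StrainDoors» — §0–§4 of nsreg-p1 g31's `r35/Sketch37.lean` sha16 265cb074f1d98fd0
(ROUND-35 c653b89364d543f7; PLATE-AID-37 a5968f2ee6b16dfe cut), every declaration byte-identical, order preserved; landed by
ns-s29-p2 g4 on LEAD ns-s30-p1 g3's key 2026-08-28T18:39:13Z (a), `--kind definition`,
`--supports stmt-NavierStokesRegularity-0056 --as helper`.  Compositions (§5–§6 / §7–§8) land in
`Theorems/StrainDoorsCompositions.lean` / `Theorems/StrainDoorsCompositionsB.lean` (gate cap: files with proofs ≤ 400 lines).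
The sketch's module docstring above is kept verbatim.  HONEST FRAME: regularity CRITERIA at one point per time (the strain
argmax); item 0056 `NoTypeII` and NS regularity are NOT proved; nothing here is a route or a summit statement.
-/

noncomputable section

open MeasureTheory Set Function Filter Metric Real InnerProductSpace
open _root_.Topology
open scoped ENNReal NNReal RealInnerProductSpace ContDiff Laplacian
open Literature.Analysis Literature.Analysis.FluidPDE
open Literature.Analysis.FluidPDE.VorticityDirectionDynamics

set_option linter.dupNamespace false

namespace Summit.NavierStokesRegularity.NavierStokesRegularity.Theorems.StrainDoors

open Summit.NavierStokesRegularity.NavierStokesRegularity.Theorems.ArgmaxDoors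

-- nested operator types (second derivatives)
set_option maxSynthPendingDepth 3
/-! ## §0 One-point strain quantities -/

/-- support (definition): the STRAIN FORM `q(t,x,e) = ⟪∇u(t,x) e, e⟫` (`= ⟪S(t,x)e, e⟫`, the antisymmetric part
drops out; for unit `e` its maximum over `e` is the top eigenvalue `λ₃(S(t,x))`, over `(x,e)` it is `Λ(t)`). -/
def strainQuad (u : ℝ → (EuclideanSpace ℝ (Fin 3)) → (EuclideanSpace ℝ (Fin 3))) (t : ℝ)
    (x e : EuclideanSpace ℝ (Fin 3)) : ℝ :=
  ⟪fderiv ℝ (u t) x e, e⟫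

/-- support (definition): `(x,e)` is a (global) STRAIN ARGMAX at time `t`: `|e| = 1` and
`⟪∇u(t,y) e', e'⟫ ≤ ⟪∇u(t,x) e, e⟫` for every `y` and every unit `e'` (`x` carries `Λ(t) = sup_y λ₃(S(t,y))`, `e` is
a top eigenvector of `S(t,x)`). -/
def IsStrainArgmax (u : ℝ → (EuclideanSpace ℝ (Fin 3)) → (EuclideanSpace ℝ (Fin 3))) (t : ℝ)
    (x e : EuclideanSpace ℝ (Fin 3)) : Prop :=
  ‖e‖ = 1 ∧ ∀ (y e' : EuclideanSpace ℝ (Fin 3)), ‖e'‖ = 1 → strainQuad u t y e' ≤ strainQuad u t x e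

/-- support (definition): the one-sided TIME DERIVATIVE of the strain form at fixed `(x,e)` in the frame's
convention: `⟪∂ₜ(∇u e)(t,x), e⟫` with `∂ₜ = timeDerivWithin (Ico 0 T)` applied to the field `(s,y) ↦ ∇u(s,y) e`. -/
def strainRate (T : ℝ) (u : ℝ → (EuclideanSpace ℝ (Fin 3)) → (EuclideanSpace ℝ (Fin 3))) (t : ℝ)
    (x e : EuclideanSpace ℝ (Fin 3)) : ℝ :=
  ⟪timeDerivWithin (Ico 0 T) (fun s y => fderiv ℝ (u s) y e) t x, e⟫

/-- support (definition): the PRESSURE HESSIAN form `∇²p(t,x)(e,e) = ⟪D(∇p(t,·))(x) e, e⟫`. -/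
def pressureHess (p : ℝ → (EuclideanSpace ℝ (Fin 3)) → ℝ) (t : ℝ) (x e : EuclideanSpace ℝ (Fin 3)) : ℝ :=
  ⟪fderiv ℝ (gradient (p t)) x e, e⟫

/-- support (definition): the STRAIN FEED along `e` at `(t,x)`: `H = ¼(|ω|² − ⟪ω,e⟫²) − ∇²p(e,e)` — the
right-hand side of the Riccati law `∂ₜ⟪∇u ē,ē⟫ ≤ −⟪∇u ē,ē⟫² + H` at a strain argmax (plate E1_S). -/
def strainFeed (u : ℝ → (EuclideanSpace ℝ (Fin 3)) → (EuclideanSpace ℝ (Fin 3)))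
    (p : ℝ → (EuclideanSpace ℝ (Fin 3)) → ℝ) (t : ℝ) (x e : EuclideanSpace ℝ (Fin 3)) : ℝ :=
  (1 / 4) * (‖curl (u t) x‖ ^ 2 - ⟪curl (u t) x, e⟫ ^ 2) - pressureHess p t x e

/-- support (definition): `|S(t,x)|²_F = |∇u(t,x)|²_F − ½|ω(t,x)|²` (the Frobenius norm of the symmetric part,
written with the tree's `frobeniusNormSq` and `curl`). -/
def strainNormSq (u : ℝ → (EuclideanSpace ℝ (Fin 3)) → (EuclideanSpace ℝ (Fin 3))) (t : ℝ)
    (x : EuclideanSpace ℝ (Fin 3)) : ℝ :=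
  frobeniusNormSq (fderiv ℝ (u t) x) - (1 / 2) * ‖curl (u t) x‖ ^ 2

/-- support (definition): the DEVIATORIC PRESSURE HESSIAN form `Π(t,x)(e,e) = ⟪H(p(t))(x) e, e⟫`, `H` = the
Literature's `deviatoricHessian` (`FluidPDE/DeviatoricHessian.lean`, the object of route IsobarTomography:
`H(q)(x) = D(∇q)(x) − (Δq(x)/3)·I`, the trace-free = Calderón–Zygmund = zero-spherical-mean part of `∇²q`);
for a unit `e`, `Π(e,e) = ∇²p(e,e) − ⅓Δp` (`devPressureHess_eq`). -/
def devPressureHess (p : ℝ → (EuclideanSpace ℝ (Fin 3)) → ℝ) (t : ℝ) (x e : EuclideanSpace ℝ (Fin 3)) : ℝ :=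
  ⟪deviatoricHessian (p t) x e, e⟫

/-- `Π(e,e) = ∇²p(e,e) − ⅓Δp` for a unit vector `e` (`dim ℝ³ = 3`). [folklore] -/
theorem devPressureHess_eq (p : ℝ → (EuclideanSpace ℝ (Fin 3)) → ℝ) (t : ℝ) (x : EuclideanSpace ℝ (Fin 3))
    {e : EuclideanSpace ℝ (Fin 3)} (he : ‖e‖ = 1) :
    devPressureHess p t x e = pressureHess p t x e - (1 / 3) * (Δ (p t)) x := by
  unfold devPressureHess pressureHess
  rw [deviatoricHessian_apply, inner_sub_left, real_inner_smul_left, real_inner_self_eq_norm_sq, he,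
    finrank_euclideanSpace_fin]
  push_cast
  ring

/-! ## §1 Door S37-Λ «SubcriticalStrainDoor» -/

/-- door S37-Λ «SubcriticalStrainDoor» (regularity criterion; the BKM integrability exponent for the strain).
`ν > 0`, `0 ≤ t₀ < T`, `y₀ < 1`, `(u,p)` in the frame. If on the end slab `[t₀,T)` the strain form is
subcritical — `(T − t)·⟪∇u(t,x) e, e⟫ ≤ y₀` for every `x` and every unit `e` (i.e. `(T−t)Λ(t) ≤ y₀`) — then `u`
continues in the Sobolev class past `T` (`‖ω(t)‖_∞ ≲ (T−t)^{−y₀}` is integrable). `y₀ = 1` is the self-similar /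
Restricted-Euler rate and is NOT covered. CLOSED from door S35-B (`subcriticalStrainDoor_holds`). -/
def SubcriticalStrainDoor : Prop :=
  ∀ (ν T t₀ y₀ : ℝ), 0 < ν → 0 ≤ t₀ → t₀ < T → y₀ < 1 →
    ∀ (u : ℝ → (EuclideanSpace ℝ (Fin 3)) → (EuclideanSpace ℝ (Fin 3)))
      (p : ℝ → (EuclideanSpace ℝ (Fin 3)) → ℝ),
      IsClassicalNSSolutionOn (Ico 0 T) ν 0 u p →
      (∀ T'' < T, HasBoundedSobolevNormsOn (Icc 0 T'') u) →
      (∀ t ∈ Ico t₀ T, ∀ (x e : EuclideanSpace ℝ (Fin 3)), ‖e‖ = 1 →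
        (T - t) * strainQuad u t x e ≤ y₀) →
      HasSobolevExtensionPast ν u T

/-! ## §2 Door S37-H «StrainFeedingDoor» -/

/-- door S37-H «StrainFeedingDoor» (regularity criterion; threshold door, the strain twin of S35-B). `ν > 0`,
`0 ≤ t₀ < T`, `0 < y₀ < 1`, `c < y₀(1 + y₀)`, `(u,p)` in the frame. If at every late time `t ∈ [t₀,T)` and every
STRAIN ARGMAX `(x̄,ē)` lying above the line `(T − t)⟪∇u(t,x̄)ē,ē⟫ > y₀` the strain feed is `c`-small —
`(T − t)²·(¼(|ω(x̄,t)|² − ⟪ω(x̄,t),ē⟫²) − ∇²p(t,x̄)(ē,ē)) ≤ c` — then `u` continues past `T`. Nothing is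
charged below the line or away from the strain argmaxes; `‖ω‖_∞` is never charged (it is slaved to `Λ`). -/
def StrainFeedingDoor : Prop :=
  ∀ (ν T t₀ y₀ c : ℝ), 0 < ν → 0 ≤ t₀ → t₀ < T → 0 < y₀ → y₀ < 1 → c < y₀ * (1 + y₀) →
    ∀ (u : ℝ → (EuclideanSpace ℝ (Fin 3)) → (EuclideanSpace ℝ (Fin 3)))
      (p : ℝ → (EuclideanSpace ℝ (Fin 3)) → ℝ),
      IsClassicalNSSolutionOn (Ico 0 T) ν 0 u p →
      (∀ T'' < T, HasBoundedSobolevNormsOn (Icc 0 T'') u) →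
      (∀ t ∈ Ico t₀ T, ∀ (x e : EuclideanSpace ℝ (Fin 3)), IsStrainArgmax u t x e →
        y₀ < (T - t) * strainQuad u t x e → (T - t) ^ 2 * strainFeed u p t x e ≤ c) →
      HasSobolevExtensionPast ν u T

/-! ## §3 Door S37-Π «PressureFocusingDoor» -/

/-- door S37-Π «PressureFocusingDoor» (regularity criterion; door H with the pressure Hessian split by the Poisson
equation `Δp = ½|ω|² − |S|²`). Same constants and frame as door H; charged at the same strain argmaxes:
`(T − t)²·(⅓|S|² + (1/12)|ω|² − ¼⟪ω,ē⟫² − Π(ē,ē)) ≤ c`, `Π = ∇²p − ⅓Δp·𝟙`. SHAPE `⅓|S|² − Λ²` ∈ `[−½Λ², Λ²]`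
(tube … sheet), ALIGNMENT `(1/12)|ω|² − ¼⟪ω,ē⟫²` ∈ `[−|ω|²/6, |ω|²/12]` (aligned … transverse), NONLOCAL FOCUSING
`−Π(ē,ē)` (zero-spherical-mean Calderón–Zygmund image of `½|ω|² − |S|²`): a blow-up must keep their sum above
`≈ (2 − local credit)/(T−t)²` at the top strain eigenvalue's argmax. -/
def PressureFocusingDoor : Prop :=
  ∀ (ν T t₀ y₀ c : ℝ), 0 < ν → 0 ≤ t₀ → t₀ < T → 0 < y₀ → y₀ < 1 → c < y₀ * (1 + y₀) →
    ∀ (u : ℝ → (EuclideanSpace ℝ (Fin 3)) → (EuclideanSpace ℝ (Fin 3)))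
      (p : ℝ → (EuclideanSpace ℝ (Fin 3)) → ℝ),
      IsClassicalNSSolutionOn (Ico 0 T) ν 0 u p →
      (∀ T'' < T, HasBoundedSobolevNormsOn (Icc 0 T'') u) →
      (∀ t ∈ Ico t₀ T, ∀ (x e : EuclideanSpace ℝ (Fin 3)), IsStrainArgmax u t x e →
        y₀ < (T - t) * strainQuad u t x e →
        (T - t) ^ 2 * ((1 / 3) * strainNormSq u t x + (1 / 12) * ‖curl (u t) x‖ ^ 2 -
          (1 / 4) * ⟪curl (u t) x, e⟫ ^ 2 - devPressureHess p t x e) ≤ c) →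
      HasSobolevExtensionPast ν u T

/-! ## §4 Plates -/

/-- plate E1_S «StrainGrowth» (M; PDE-free vector calculus at a strain argmax; Majda–Bertozzi (1.29) paired with
`ē ⊗ ē`). `ν ≥ 0`, `v` smooth, `|ē| = 1`, `x̄` a global maximum point of `x ↦ ⟪∇v(x) ē, ē⟫`; if a vector `w`
satisfies the momentum equation differentiated along `ē` at `x̄` — `w + D((v·∇)v)(x̄)ē = ν D(Δv)(x̄)ē − D(∇q)(x̄)ē` —
then `⟪w, ē⟫ ≤ −⟪∇v(x̄)ē,ē⟫² + ¼(|ω(x̄)|² − ⟪ω(x̄),ē⟫²) − ⟪D(∇q)(x̄)ē, ē⟫` (`ω = curl v`). Ingredients: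
`⟪D((v·∇)v)(x̄)ē,ē⟫ = (v·∇)⟪∇v ē,ē⟫(x̄) + ⟪∇v(∇v ē), ē⟫` with the first term `= 0` (Fermat at the maximum);
`⟪A(Aē),ē⟫ = ⟪Aē, Aᵀē⟫`, `Aᵀē = Aē − ω × ē`, so `⟪A²ē,ē⟫ = |Aē − ½ω×ē|² − ¼|ω×ē|² ≥ ⟪Aē,ē⟫² − ¼(|ω|² − ⟪ω,ē⟫²)`;
`⟪D(Δv)(x̄)ē, ē⟫ = Δ⟪∇v ē,ē⟫(x̄) ≤ 0` (second-order condition at the maximum). No pressure hypothesis is used. -/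
def StrainGrowth : Prop :=
  ∀ (ν : ℝ), 0 ≤ ν →
    ∀ (v : (EuclideanSpace ℝ (Fin 3)) → (EuclideanSpace ℝ (Fin 3))) (q : (EuclideanSpace ℝ (Fin 3)) → ℝ),
      ContDiff ℝ ∞ v →
      ∀ (x₀ e₀ : EuclideanSpace ℝ (Fin 3)), ‖e₀‖ = 1 →
        (∀ y, ⟪fderiv ℝ v y e₀, e₀⟫ ≤ ⟪fderiv ℝ v x₀ e₀, e₀⟫) →
        ∀ w : EuclideanSpace ℝ (Fin 3),
          w + fderiv ℝ (convect v v) x₀ e₀ = ν • fderiv ℝ (Δ v) x₀ e₀ - fderiv ℝ (gradient q) x₀ e₀ →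
          ⟪w, e₀⟫ ≤ -⟪fderiv ℝ v x₀ e₀, e₀⟫ ^ 2 + (1 / 4) * (‖curl v x₀‖ ^ 2 - ⟪curl v x₀, e₀⟫ ^ 2) -
            ⟪fderiv ℝ (gradient q) x₀ e₀, e₀⟫

/-- plate F_S «StrainFrame» (S; the momentum equation differentiated in space). In the frame, for every
`t ∈ [0,T)`, `x`, `e`: `∂ₜ(∇u e)(t,x) + D((u·∇)u)(x) e = ν D(Δu)(x) e − D(∇p)(x) e`, where `∂ₜ(∇u e)` is the
one-sided time derivative within `[0,T)` of the field `(s,y) ↦ ∇u(s,y)e` (mixed partials commute: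
`IsSmoothSpaceTimeOn.timeDerivWithin_fderiv_slice_apply`; then differentiate `momentum` in `x`). -/
def StrainFrame : Prop :=
  ∀ (ν T : ℝ), 0 < ν → 0 < T →
    ∀ (u : ℝ → (EuclideanSpace ℝ (Fin 3)) → (EuclideanSpace ℝ (Fin 3)))
      (p : ℝ → (EuclideanSpace ℝ (Fin 3)) → ℝ),
      IsClassicalNSSolutionOn (Ico 0 T) ν 0 u p →
      ∀ t ∈ Ico 0 T, ∀ (x e : EuclideanSpace ℝ (Fin 3)),
        timeDerivWithin (Ico 0 T) (fun s y => fderiv ℝ (u s) y e) t x + fderiv ℝ (convect (u t) (u t)) x e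
          = ν • fderiv ℝ (Δ (u t)) x e - fderiv ℝ (gradient (p t)) x e

/-- plate E2_S «StrainThreshold» (M; RICCATI FIRST-TOUCH COMPARISON for the `(x,e)`-family — the strain twin of
`ArgmaxDoorsSupNorm.norm_le_supersolution_of_argmax_growth`, additive device). In the frame, on a slab
`[t₁,t₂] ⊂ [0,T)`: `B > 0` continuous with one-sided derivative `B'` within `[t₁,t₂]`, `h ≥ 0`, and
`−B² + h ≤ B'` (a supersolution of `y' = −y² + h(t)`); if at every `t ∈ (t₁,t₂]` and every strain argmax `(x̄,ē)` AT WHICH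
`⟪∇u ē,ē⟫ > B(t)` the one-sided rate obeys `∂ₜ⟪∇u ē,ē⟫ ≤ −⟪∇u ē,ē⟫² + h(t)`, and `⟪∇u(t₁,x)e,e⟫ ≤ B(t₁)` for all
`x`, unit `e`, then `⟪∇u(t,x)e,e⟫ ≤ B(t)` on the slab. Proof: `ψ_ε = ⟪∇u e,e⟫ − B − ε(t − t₁)` attains a positive
maximum over `[t₁,t₂] × ℝ³ × S²` (uniform decay of `∇u` on the slab, `B ≥ b > 0`) at `(t*,x*,e*)` with `t* > t₁`,
`(x*,e*)` a strain argmax, `⟪∇u e*,e*⟫ > B(t*)`; one-sided Fermat gives `∂ₜ⟪∇u e*,e*⟫ ≥ B' + ε > −B² + h >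
−⟪∇u e*,e*⟫² + h`, contradiction. -/
def StrainThreshold : Prop :=
  ∀ (ν T t₁ t₂ : ℝ), 0 < ν → 0 ≤ t₁ → t₁ < t₂ → t₂ < T →
    ∀ (u : ℝ → (EuclideanSpace ℝ (Fin 3)) → (EuclideanSpace ℝ (Fin 3)))
      (p : ℝ → (EuclideanSpace ℝ (Fin 3)) → ℝ),
      IsClassicalNSSolutionOn (Ico 0 T) ν 0 u p →
      (∀ T'' < T, HasBoundedSobolevNormsOn (Icc 0 T'') u) →
      ∀ (B B' h : ℝ → ℝ), ContinuousOn B (Icc t₁ t₂) → (∀ t ∈ Icc t₁ t₂, 0 < B t) →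
        (∀ t ∈ Icc t₁ t₂, HasDerivWithinAt B (B' t) (Icc t₁ t₂) t) →
        (∀ t ∈ Icc t₁ t₂, -(B t) ^ 2 + h t ≤ B' t) → (∀ t ∈ Icc t₁ t₂, 0 ≤ h t) →
        (∀ t ∈ Ioc t₁ t₂, ∀ (x e : EuclideanSpace ℝ (Fin 3)), IsStrainArgmax u t x e →
          B t < strainQuad u t x e → strainRate T u t x e ≤ -(strainQuad u t x e) ^ 2 + h t) →
        (∀ (x e : EuclideanSpace ℝ (Fin 3)), ‖e‖ = 1 → strainQuad u t₁ x e ≤ B t₁) →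
        ∀ t ∈ Icc t₁ t₂, ∀ (x e : EuclideanSpace ℝ (Fin 3)), ‖e‖ = 1 → strainQuad u t x e ≤ B t

/-- plate E2_S-lin «StrainThresholdLinear» (S over the tree: the NS INSTANCE of the LEAD's landed abstract device
`ArgmaxDoors.rayleigh_le_supersolution_of_argmax_growth`, p655218 `Theorems/StrainDoorsThreshold.lean`, after a
time shift `[t₁,t₂] ↦ [0,t₂−t₁]`, `W s x := ∇u(t₁+s,x)` jointly smooth by `smooth_velocity.fderiv_slice`).
LINEAR growth form `∂ₜ⟪∇u ē,ē⟫ ≤ φ(t)⟪∇u ē,ē⟫` at the charged strain argmaxes, `φB ≤ B'`, WITH the uniform decay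
of `∇u` on the slab as a HYPOTHESIS (supplied by plate D_S). -/
def StrainThresholdLinear : Prop :=
  ∀ (ν T t₁ t₂ : ℝ), 0 < ν → 0 ≤ t₁ → t₁ < t₂ → t₂ < T →
    ∀ (u : ℝ → (EuclideanSpace ℝ (Fin 3)) → (EuclideanSpace ℝ (Fin 3)))
      (p : ℝ → (EuclideanSpace ℝ (Fin 3)) → ℝ),
      IsClassicalNSSolutionOn (Ico 0 T) ν 0 u p →
      (∀ T'' < T, HasBoundedSobolevNormsOn (Icc 0 T'') u) →
      (∀ η : ℝ, 0 < η → ∃ R : ℝ, ∀ t ∈ Icc t₁ t₂, ∀ x : EuclideanSpace ℝ (Fin 3),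
          R ≤ ‖x‖ → ‖fderiv ℝ (u t) x‖ ≤ η) →
      ∀ (B B' φ : ℝ → ℝ), ContinuousOn B (Icc t₁ t₂) → (∀ t ∈ Icc t₁ t₂, 0 < B t) →
        (∀ t ∈ Icc t₁ t₂, HasDerivWithinAt B (B' t) (Icc t₁ t₂) t) →
        (∀ t ∈ Icc t₁ t₂, φ t * B t ≤ B' t) →
        (∀ t ∈ Ioc t₁ t₂, ∀ (x e : EuclideanSpace ℝ (Fin 3)), IsStrainArgmax u t x e →
          B t < strainQuad u t x e → strainRate T u t x e ≤ φ t * strainQuad u t x e) →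
        (∀ (x e : EuclideanSpace ℝ (Fin 3)), ‖e‖ = 1 → strainQuad u t₁ x e ≤ B t₁) →
        ∀ t ∈ Icc t₁ t₂, ∀ (x e : EuclideanSpace ℝ (Fin 3)), ‖e‖ = 1 → strainQuad u t x e ≤ B t

/-- plate D_S «GradientUniformDecay» (M; the LEAD's frame note 2026-08-28T18:02:48Z). In the frame, on every
closed slab `[0,T''] ⊂ [0,T)`: `‖∇u(t,x)‖ → 0` as `|x| → ∞` UNIFORMLY in `t ∈ [0,T'']` — the compactness input
that makes `Λ(t) = sup ⟪∇u e,e⟫` and the first-touch maxima ATTAINED. Why it is a plate and not free: the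
vorticity twin `ArgmaxDoorsFrame.vorticity_uniform_decay` (p644966) used the PRESSURE-FREE vorticity equation for a
uniform time-Lipschitz bound; `∂ₜ∇u = ν∇Δu − ∇((u·∇)u) − ∇²p` needs `sup |∇²p|` on closed slabs, i.e. (i) the
harmonic part of `∇p` vanishes because `u(t) ∈ L²` for all `t` (Liouville for `L²` harmonic gradients after time
integration) and (ii) the Newtonian-potential Hessian bound `sup|∇²p₀| ≲ ‖tr(∇u∇u)‖_{H²∩L¹}` (Calderón–Zygmund on
`H^k`); alternative: Biot–Savart `∇u = CZ[ω]` + `vorticity_uniform_decay` + enstrophy-tail tightness. The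
ALMOST-MAXIMISER twins of the doors (LEAD 18:03:18Z, device `ArgmaxDoorsAlmostArgmax`, p648617) avoid D_S. -/
def GradientUniformDecay : Prop :=
  ∀ (ν T : ℝ), 0 < ν → 0 < T →
    ∀ (u : ℝ → (EuclideanSpace ℝ (Fin 3)) → (EuclideanSpace ℝ (Fin 3)))
      (p : ℝ → (EuclideanSpace ℝ (Fin 3)) → ℝ),
      IsClassicalNSSolutionOn (Ico 0 T) ν 0 u p →
      (∀ T'' < T, HasBoundedSobolevNormsOn (Icc 0 T'') u) →
      ∀ T'' < T, ∀ η : ℝ, 0 < η → ∃ R : ℝ, ∀ t ∈ Icc 0 T'', ∀ x : EuclideanSpace ℝ (Fin 3),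
        R ≤ ‖x‖ → ‖fderiv ℝ (u t) x‖ ≤ η

/-- plate «PoissonTrace» (S; the pressure Poisson equation pointwise). In the frame, at every interior time and
every point: `Δp = −tr(∇u ∘ ∇u) = |ω|² − |∇u|²_F` (`= ½|ω|² − |S|²`; divergence of `momentum`, `div u = 0`;
cf. `Ferrari1993PressureNeumannProblem.laplacian_pressure_eq_of_mem_Ioo` for the trace form on a cylinder). -/
def PoissonTrace : Prop :=
  ∀ (ν T : ℝ), 0 < ν → 0 < T →
    ∀ (u : ℝ → (EuclideanSpace ℝ (Fin 3)) → (EuclideanSpace ℝ (Fin 3)))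
      (p : ℝ → (EuclideanSpace ℝ (Fin 3)) → ℝ),
      IsClassicalNSSolutionOn (Ico 0 T) ν 0 u p →
      ∀ t ∈ Ioo 0 T, ∀ (x : EuclideanSpace ℝ (Fin 3)),
        (Δ (p t)) x = ‖curl (u t) x‖ ^ 2 - frobeniusNormSq (fderiv ℝ (u t) x)

end Summit.NavierStokesRegularity.NavierStokesRegularity.Theorems.StrainDoors

end
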